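import Literature.NumberTheory.EllipticCurves.HeegnerPointsKolyvaginEulerSystem
import Literature.NumberTheory.EllipticCurves.BertoliniDarmon2005.AdmissiblePrimes
import Mathlib.Data.Nat.Squarefree
import HarnessLib

/-!
# W. Zhang's level-raised Kolyvagin classes `c(n, m) ∈ H¹(K, V)` as pinned DATA

Topic `Literature/NumberTheory/EllipticCurves`; definition item `defn-ZhangLevelRaisedKolyvaginData`
(cell `bsd-stepL`, planner g27, for the KOLY crux `stmt-BirchSwinnertonDyer-19574`; the "R-c
vocabulary" of the planner's ruling of 2026-08-26). DEFINITIONS WITH BODIES / a STRUCTURE of DATA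
with definitional constraints only: no named fact, no `sorry`, no instance, no notation. Nothing is
asserted to EXIST; the level-raising theorem (Thm. 2.1), the cohomological congruence (Thm. 4.3) and
the rank-one non-vanishing (Thm. 7.2) are NOT part of this file — they are facts/cruxes to be stated
OVER a datum `d : ZhangLevelRaisedKolyvaginData …` (about its pinned fields), elsewhere.

## Source: W. Zhang, *Selmer groups and the indivisibility of Heegner points*, Camb. J. Math. 2
## (2014) 191–253 [WZhang2014], pp. 202–218 (first-hand, corpus `paper:doi-10-4310-cjm-2014-v2-n2-a2`)

LETTERS AS PRINTED (the item text swaps them): `n ∈ Λ` = square-free products of KOLYVAGIN primes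
(Notations (xii)); `m ∈ Λ'` = square-free products of ADMISSIBLE primes (Notations (xiv): *"a prime
`q` is called admissible if `q` is prime to `N D p`, inert in `K`, `p` does not divide `q² − 1`, and
`v_p((q + 1)² − a_q²) ≥ 1`"* — the tree's `BertoliniDarmon2005.IsAdmissiblePrime N K a p 1`);
`Λ'^±` = the `m` with `(−1)^{ν(m)} = ±1`.

* **Thm. 2.1 + p. 204** (level raising, Ribet/Diamond–Taylor, `p ≥ 5` there): for `m ∈ Λ'` a
  weight-two newform `g_m` of level `N m`, trivial nebentypus, with a prime `𝔭_m` of `𝒪_{g_m}`,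
  `k_m ⊇ k₀ = 𝒪_{g,0}/𝔭₀ ≃ 𝒪_{g_m,0}/𝔭_{m,0}`, and *"for all primes `ℓ ≠ q`, we have
  `a_ℓ(g) mod 𝔭 ≡ a_ℓ(g') mod 𝔭'`, where both sides lie in `k₀`"*; *"The modular form `g_m` and `g`
  carry isomorphic `Gal_ℚ`-actions on the two-dimensional `k₀`-vector space … denote the underlying
  two-dimensional `k₀`-vector space by `V`."* For `g = f_E` (an elliptic curve `E/ℚ`): `𝒪 = ℤ`,
  `k₀ = 𝔽_p`, `V = E[p]`.
* **§3.1–3.2** for `m ∈ Λ'^+`: the Shimura curve `X_m = X_{N⁺,N⁻m}`, `A_m = A_{g_m}` a quotient of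
  `J(X_m)`, CM points `x_m(n) ∈ X_m(K[n])`, `y_m(n) ∈ A_m(K[n]) ⊗ ℚ` ((3.2)); `X_1 = X₀(N)` if
  `N⁻ = 1`. **§3.3** for `m ∈ Λ'^-`: the Shimura SET `X_m` and `x_m(n) ∈ C_{K,m} → X_m`.
* **§3.7, (3.21)–(3.22)**: Kolyvagin derivative `P(n) = ∑_σ σ(D_n y(n))`, its Kummer image descends
  to `c_M(n) ∈ H¹(K, A_{g,M})`; *"When `n = 1`, we also denote (3.22) `y_K := P(1) = tr_{K[1]/K} y(1)
  ∈ A(K)`, and the point `y_K ∈ A(K)` is usually called the Heegner point. This is the only case where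
  the derivative operator is trivial"*.
* **§3.9, Lemma 3.3 (3.29)–(3.30)** (under Hypothesis ♥): `J(X_m)[𝔪_m] ≃ V ≃ A⁰_{g_m}[𝔭_{m,0}]`
  as `Gal_ℚ`-modules and *"for each `n ∈ Λ` and `m ∈ Λ'^+` … the Kolyvagin cohomology class (3.30)
  `c(n, m) ∈ H¹(K, J(X_m)[𝔪_m]) ≃ H¹(K, V)`, as the derived cohomological class from the Heegner point
  `x_m(n)` … When `m = 1` we simply write `c(n) = c(n, 1) ∈ H¹(K, V)`. Note that these classes only
  take values in `V` … `κ_m := {c(n, m) ∈ H¹(K, V) : n ∈ Λ}`, and we will again call `κ_m` a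
  Kolyvagin system."* **Remark 8**: the classes depend on CHOICES (of `g_m`, of the generators
  `σ_ℓ`, of the parametrisation of Heegner points) — *"it will suffice to fix a choice for each
  `m ∈ Λ'^+`"* — which is why they are DATA here.

## What is typed, and what is deliberately NOT

For `E/ℚ` given by a Weierstrass model `W` (`g = f_E`, so `V = E[p]` and
`H¹(K, V) = galH1Torsion (W.baseChange K) p`, the currency of `HeegnerPointsKolyvaginEulerSystem`
and of the KOLY skeleton's `Method2Defs.V3` at `p = 3`), level `N`, Hecke eigenvalues `a ℓ = a_ℓ(E)`
(e.g. `W.frobeniusTrace ℓ` for a globally minimal `W`), a number field `K` and a prime `p` (ANY `p`;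
`p = 3` allowed — the print's `p ≥ 5` / Hypothesis ♥ are hypotheses of the FACTS, not of the data),
and the bottom Heegner point `y_K ∈ E(K)` of the frame (a parameter, so that the consumer's own
`y_K` is the anchor): the structure `ZhangLevelRaisedKolyvaginData N W K a p yK` bundles, for ALL
levels `m` at once (`m : Finset ℕ`, a square-free product as the set of its prime factors),
(1) the RESIDUAL HECKE EIGENSYSTEM `(m, ℓ) ↦ a_ℓ(g_m) mod 𝔭_{m,0} ∈ k₀ = 𝔽_p` of the level-raised
forms, with the printed congruence as its definitional constraint (away from `N m p`, where
`a_ℓ(f_E) = a ℓ` is the trace of Frobenius), and (2) the KOLYVAGIN CLASSES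
`(m, n) ↦ c(n, m) ∈ H¹(K, E[p])` with the one printed definitional identity expressible in the
tree's currency: `c(1, 1) = δ(y_K)` ((3.21)–(3.22) with (3.30) at `m = 1`: the derivative operator is
trivial and the class is the Kummer image; tree `kummerClassOfPoint`).
-- TODO(general form): (i) `g_m` itself (a newform of level `N·m` with `𝒪_{g_m}`, `𝔭_m`, `k_m`),
-- the Shimura curve `X_m`, the `(𝒪, 𝔭)`-optimal quotient `A_m` and `ι_m : A⁰_{g_m}[𝔭_{m,0}] ≃ V`
-- (Lemma 3.3) are NOT separate fields: the tree has no Shimura curves / GL₂-type abelian varieties,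
-- and by (3.29)–(3.30) every object the method consumes is transported to `H¹(K, V)`, where Zhang
-- himself places `c(n, m)` ("these classes only take values in `V`"); the A_m-Selmer group is typed
-- INTRINSICALLY in `H¹(K, V)` by the consumer (`Method2Defs.levelSelmerSubgroup`: E's Kummer condition
-- off `m`, the ordinary condition at `q ∈ m`), so `c(n, m) = derivative of y_m(n) through ι_m` is
-- recorded only at `(n, m) = (1, 1)`; (ii) the DEFINITE side `m ∈ Λ'^-` (Shimura set `X_m`, the
-- `k₀`-valued Jacquet–Langlands eigenform `φ` of (4.7) and its values on `x_m(n)`) is not typed here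
-- (it enters only the PROOF of Thm. 4.3, not the statements (A2)/(A5) the KOLY skeleton quotes);
-- (iii) general `(N⁺, N⁻)`: the bottom anchor uses the frame's `y_K ∈ E(K)` (for the tree's
-- `IsHeegnerPoint`, `X_1 = X₀(N)`, i.e. `N⁻ = 1`).

## Main definitions

* `IsZhangAdmissibleLevel N K a p m` — `m ∈ Λ'`: a finite set of (1-)admissible primes
  (`BertoliniDarmon2005.IsAdmissiblePrime N K a p 1`); `IsZhangEvenAdmissibleLevel` — `m ∈ Λ'^+`.
* `IsKolyvaginLevel N W K p n` — `n ∈ Λ`: square-free, all prime factors Kolyvagin primes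
  (`IsKolyvaginPrime`, as in `Gross1991_kolyvaginClasses`).
* `ZhangLevelRaisedKolyvaginData N W K a p yK` — the structure; `.kolyvaginSystem d m = κ_m`.
-/

noncomputable section

open scoped Classical

open WeierstrassCurve NumberField

universe u

namespace Literature.NumberTheory.EllipticCurves

section Levels

variable (N : ℕ) (K : Type u) [Field K] (a : ℕ → ℤ) (p : ℕ)

/-- **`m ∈ Λ'`** (W. Zhang 2014, Notations (xiv)): `m` is a square-free product of ADMISSIBLE primes,
recorded as the finite set of its prime factors, each admissible in the printed sense *"`q` prime to
`N D p`, inert in `K`, `p ∤ q² − 1`, `v_p((q + 1)² − a_q²) ≥ 1`"* = Bertolini–Darmon `1`-admissible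
(tree `BertoliniDarmon2005.IsAdmissiblePrime N K a p 1`; inert ⇒ unramified ⇒ `q ∤ D`).
[cite: WZhang2014, Notations (xiv) (p. 202)] -/
def IsZhangAdmissibleLevel (m : Finset ℕ) : Prop :=
  ∀ q ∈ m, BertoliniDarmon2005.IsAdmissiblePrime N K a p 1 q

/-- **`m ∈ Λ'^+`**: an admissible level with an EVEN number of prime factors (`(−1)^{ν(m)} = +1`),
the levels carrying Shimura CURVES `X_m = X_{N⁺,N⁻m}` and the classes `c(n, m)` (§3.1, §3.9).
[cite: WZhang2014, Notations (xiv) and §3.1 (m ∈ Λ'^+)] -/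
def IsZhangEvenAdmissibleLevel (m : Finset ℕ) : Prop :=
  IsZhangAdmissibleLevel N K a p m ∧ Even m.card

variable {N K a p}

/-- `1 ∈ Λ'` (the empty product): *"We also include 1 into Λ"* / "Similarly define `Λ'_r`, …".
[cite: WZhang2014, Notations (xii), (xiv)] -/
theorem isZhangAdmissibleLevel_empty : IsZhangAdmissibleLevel N K a p ∅ :=
  fun _ h ↦ absurd h (Finset.notMem_empty _)

/-- `1 ∈ Λ'^+` (`ν(1) = 0` is even). [cite: WZhang2014, Notations (xiv) and §3.1] -/
theorem isZhangEvenAdmissibleLevel_empty : IsZhangEvenAdmissibleLevel N K a p ∅ :=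
  And.intro isZhangAdmissibleLevel_empty (by simp)

/-- `Λ'` is closed under passing to divisors (sub-products). [cite: WZhang2014, Notations (xiv)] -/
theorem IsZhangAdmissibleLevel.mono {m m' : Finset ℕ} (hm : IsZhangAdmissibleLevel N K a p m)
    (h : m' ⊆ m) : IsZhangAdmissibleLevel N K a p m' :=
  fun q hq ↦ hm q (h hq)

/-- There are no admissible primes, hence no non-trivial admissible levels, at `p = 3`
(`3 ∣ q² − 1`; tree `BertoliniDarmon2005.not_isAdmissiblePrime_three`) — the reason the KOLY
skeleton at `p = 3` uses UNIPOTENT-admissible primes (`Method2Defs.IsUAdmissiblePrime`) instead.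
[cite: WZhang2014, Notations (xiv) (p ∤ q² − 1)] -/
theorem isZhangAdmissibleLevel_three_iff {m : Finset ℕ} :
    IsZhangAdmissibleLevel N K a 3 m ↔ m = ∅ := by
  refine ⟨fun h ↦ Finset.eq_empty_of_forall_notMem fun q hq ↦ ?_,
    fun h ↦ h ▸ isZhangAdmissibleLevel_empty⟩
  exact BertoliniDarmon2005.not_isAdmissiblePrime_three q (h q hq)

end Levels

section KolyvaginLevels

variable (N : ℕ) (W : WeierstrassCurve ℚ) (K : Type u) [Field K] [NumberField K] (p : ℕ)

/-- **`n ∈ Λ`** (W. Zhang 2014, Notations (xii): square-free products of Kolyvagin primes, `1 ∈ Λ`):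
`n` square-free with every prime factor a Kolyvagin prime (tree `IsKolyvaginPrime N W K p`, Gross's
(3.1)–(3.2), as used by `Gross1991_kolyvaginClasses`). [cite: WZhang2014, Notations (xii) (p. 202)] -/
def IsKolyvaginLevel (n : ℕ) : Prop :=
  Squarefree n ∧ ∀ ℓ ∈ n.primeFactors, IsKolyvaginPrime N W K p ℓ

variable {N W K p}

/-- `1 ∈ Λ`. [cite: WZhang2014, Notations (xii)] -/
theorem isKolyvaginLevel_one : IsKolyvaginLevel N W K p 1 :=
  ⟨squarefree_one, fun ℓ hℓ ↦ absurd hℓ (by simp)⟩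

end KolyvaginLevels

section Data

variable (N : ℕ) (W : WeierstrassCurve ℚ) (K : Type u) [Field K] [NumberField K] (a : ℕ → ℤ)
  (p : ℕ) [Fact p.Prime] (yK : (W.baseChange K).toAffine.Point)

/-- **W. Zhang's level-raised Kolyvagin data for `E/ℚ` over `K` at `p`** (Camb. J. Math. 2 (2014),
§§2–3), PINNED AS DATA for all admissible levels at once: for each `m` (meant: `m ∈ Λ'^+`) the
residual Hecke eigensystem `ℓ ↦ a_ℓ(g_m) mod 𝔭_{m,0} ∈ k₀ = 𝔽_p` of the chosen level-raised newform
`g_m` of level `N·m` (Thm. 2.1, p. 204) and the chosen Kolyvagin classes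
`n ↦ c(n, m) ∈ H¹(K, V) = H¹(K, E[p])` ((3.30); `n ∈ Λ`), subject ONLY to the printed definitional
constraints expressible in the tree's currency: the level-raising congruence
`a_ℓ(g_m) ≡ a_ℓ(g) = a_ℓ(E) (mod 𝔭_m)` for primes `ℓ ∉ m`, `ℓ ∤ N p` (Thm. 2.1, displayed
equivalent form), `g_1 = g = f_E`, and `c(1, 1) = δ(y_K)` ((3.21)–(3.22), (3.30) at `m = 1`). The
parameters: level `N`, model `W` of `E`, the field `K`, `a ℓ = a_ℓ(E)`, the prime `p`, and the
frame's Heegner point `y_K ∈ E(K)`. Values at non-admissible `m` / non-Kolyvagin `n` are junk.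
Existence (Thm. 2.1, the Heegner-point construction §3) is NOT claimed; see the module docstring for
what is not typed (`g_m`, `X_m`, `A_m`, `ι_m` as separate objects; the definite side).
[cite: WZhang2014, Thm. 2.1 and p. 204 (g_m, 𝔭_m, k₀, V); §3.7 (3.21)–(3.22); §3.9 (3.29)–(3.30), Remark 8] -/
structure ZhangLevelRaisedKolyvaginData where
  /-- `(m, ℓ) ↦ a_ℓ(g_m) mod 𝔭_{m,0} ∈ k₀ = 𝔽_p`: the residual Hecke eigensystem of the level-raised
  newform `g_m` (p. 204: "all notations for `g` will have their counterparts for `g_m`"). -/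
  heckeEigenvalueModP : Finset ℕ → ℕ → ZMod p
  /-- `g_1 = g = f_E`: at the bottom level the eigensystem is that of `E`, `a_ℓ(E) = a ℓ` at the primes
  `ℓ ∤ N p` (Notations: `g` the newform attached to `E`). -/
  heckeEigenvalueModP_empty : ∀ ℓ : ℕ, ℓ.Prime → ¬ ℓ ∣ N * p → heckeEigenvalueModP ∅ ℓ = (a ℓ : ZMod p)
  /-- **Thm. 2.1 (displayed form)**: *"for all primes `ℓ ≠ q`, we have `a_ℓ(g) mod 𝔭 ≡ a_ℓ(g') mod 𝔭'`,
  where both sides lie in `k₀`"* — iterated along `m ∈ Λ'` (p. 204): away from `m` the residual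
  eigensystem of `g_m` is that of `g`. -/
  congr : ∀ m : Finset ℕ, IsZhangAdmissibleLevel N K a p m →
    ∀ ℓ : ℕ, ℓ.Prime → ℓ ∉ m → heckeEigenvalueModP m ℓ = heckeEigenvalueModP ∅ ℓ
  /-- `(m, n) ↦ c(n, m) ∈ H¹(K, V)`, `V = E[p]` ((3.30)): the Kolyvagin class derived from the Heegner
  point `x_m(n) ∈ X_m(K[n])`, `y_m(n) ∈ A⁰_{g_m}(K[n])`, transported to `H¹(K, V)` by (3.29). -/
  kolyvaginClass : Finset ℕ → ℕ → galH1Torsion (W.baseChange K) p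
  /-- **(3.21)–(3.22) with (3.30) at `m = 1`, `n = 1`**: `c(1) = c(1, 1)` is the Kummer image of
  `y_K = P(1) = tr_{K[1]/K} y(1) ∈ E(K)` ("the only case where the derivative operator is trivial");
  tree `kummerClassOfPoint` (`= δ y_K`, as `c(1) = δ y_K` in `Gross1991_kolyvaginClasses`). -/
  kolyvaginClass_empty_one : kolyvaginClass ∅ 1 = kummerClassOfPoint W K (Fact.out : p.Prime) yK

namespace ZhangLevelRaisedKolyvaginData

variable {N W K a p yK} (d : ZhangLevelRaisedKolyvaginData N W K a p yK)

/-- **The Kolyvagin system `κ_m := {c(n, m) ∈ H¹(K, V) : n ∈ Λ}`** at the admissible level `m`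
((3.30), p. 215 and §4.2 p. 218). [cite: WZhang2014, §3.9 (3.30) (κ_m)] -/
def kolyvaginSystem (m : Finset ℕ) : Set (galH1Torsion (W.baseChange K) p) :=
  {c | ∃ n : ℕ, IsKolyvaginLevel N W K p n ∧ d.kolyvaginClass m n = c}

/-- `c(n, m) ∈ κ_m` for `n ∈ Λ`. [cite: WZhang2014, §3.9 (3.30) (κ_m)] -/
theorem kolyvaginClass_mem_kolyvaginSystem {m : Finset ℕ} {n : ℕ} (hn : IsKolyvaginLevel N W K p n) :
    d.kolyvaginClass m n ∈ d.kolyvaginSystem m :=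
  ⟨n, hn, rfl⟩

/-- `c(1) = δ(y_K)` lies in the bottom Kolyvagin system `κ_1` (`1 ∈ Λ`).
[cite: WZhang2014, §3.7 (3.22) and §3.9 (3.30)] -/
theorem kummerClassOfPoint_mem_kolyvaginSystem_empty :
    kummerClassOfPoint W K (Fact.out : p.Prime) yK ∈ d.kolyvaginSystem ∅ :=
  d.kolyvaginClass_empty_one ▸ d.kolyvaginClass_mem_kolyvaginSystem isKolyvaginLevel_one

/-- The residual eigensystem of `g_m` agrees with `a_ℓ(E) mod p` at every prime `ℓ ∉ m`, `ℓ ∤ N p`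
(Thm. 2.1 iterated, combined with `g_1 = f_E`). [cite: WZhang2014, Thm. 2.1 and p. 204] -/
theorem heckeEigenvalueModP_eq_of_not_mem {m : Finset ℕ} (hm : IsZhangAdmissibleLevel N K a p m)
    {ℓ : ℕ} (hℓ : ℓ.Prime) (hℓm : ℓ ∉ m) (hℓN : ¬ ℓ ∣ N * p) :
    d.heckeEigenvalueModP m ℓ = (a ℓ : ZMod p) := by
  rw [d.congr m hm ℓ hℓ hℓm, d.heckeEigenvalueModP_empty ℓ hℓ hℓN]

end ZhangLevelRaisedKolyvaginData

end Data

end Literature.NumberTheory.EllipticCurves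

end
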